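import Summits.QuantumFields.YangMills.Theorems.WilsonVillainDualStiffnessHartmanWatsonMixtureOfLaw
import Literature.Probability.HartmanWatson1974.HartmanWatsonLawProof
import HarnessLib

/-!
# Routes `WilsonVillainDualStiffness` (child 2) / `WilsonVillainPerimeterTransfer` (r4): the shared crux
# `HartmanWatsonMixture` ⟨stmt-QuantumFields-26809⟩ — CLOSED

The crux (Hartman–Watson mixture of the Wilson `U(1)` plaquette weight into circle heat kernels + the hot-set tail bound) was
reduced by the registered skeleton (planner `ym-idea-3` g6; stubs `stub_arcMassLowerBound` ✓p659513, `stub_tailFromArcBound`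
✓p660236, composition `hartmanWatsonMixture_of_law` ✓p660658) to the single named fact
`Literature.Probability.HartmanWatson1974.HartmanWatsonLaw` (existence of the Hartman–Watson mixing measure,
[HartmanWatson1974; Yor1980]).  That fact is now a THEOREM of the tree —
`Literature.Probability.HartmanWatson1974.HartmanWatsonLaw_holds` (`HartmanWatsonLawProof.lean`: complete monotonicity of
`u ↦ I_{√(2u)}(β)` via the Duhamel/Neumann series of Bessel-process kernels in the index + Bernstein's theorem) — so the crux
holds unconditionally, for BOTH route declarations (identical bodies).

HONEST FRAMING: this closes ONE crux (1-D analysis in print) shared by two DRAFT routes of the `U(1)` helicity-gap node; the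
sibling cruxes (`WilsonDilutedVillainComparison`, the perimeter-transfer items), the node `U1HelicityGapTorusD4`, every LADDER-YM
rung and the Yang–Mills mass gap are NOT proved by this.  Seat `ym-line-frs-p2` g13 (lineage g9 → g12 → g13).
[cite: HartmanWatson1974, Theorem]
-/

namespace Summit.QuantumFields.YangMills.Theorems

open Summit.QuantumFields.YangMills.Cruxes.HartmanWatsonMixture (hartmanWatsonMixture_of_law hartmanWatsonMixture_of_law')
open Literature.Probability.HartmanWatson1974 (HartmanWatsonLaw_holds)

/-- **Registered stub `stub_mixingMeasureExists` of the crux skeleton, BY NAME AND SIGNATURE** (the existence half = the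
Hartman–Watson theorem in the crux's moment normalisation `(1/π)∫_0^π e^{β cos θ} cos(kθ) dθ = ∫ e^{-k²t/2} dΘ`): the tree's
`stub_mixingMeasureExists_of_law` (p660658) applied to `HartmanWatsonLaw_holds`. [cite: HartmanWatson1974, Theorem] -/
theorem stub_mixingMeasureExists : ∀ β : ℝ, 0 < β → ∃ Θ : MeasureTheory.Measure ℝ, MeasureTheory.IsFiniteMeasure Θ ∧ Θ (Set.Iic 0) = 0 ∧ (∀ k : ℤ, ((∫ θ in (0:ℝ)..Real.pi, Real.exp (β * Real.cos θ) * Real.cos (((k : ℤ) : ℝ) * θ)) / Real.pi) = ∫ t, Real.exp (-(((k : ℝ) ^ 2) * t) / 2) ∂Θ) :=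
  Summit.QuantumFields.YangMills.Cruxes.HartmanWatsonMixture.stub_mixingMeasureExists_of_law HartmanWatsonLaw_holds

/-- **Crux ⟨stmt-QuantumFields-26809⟩ `WilsonVillainDualStiffness.HartmanWatsonMixture`, proved**: Hartman–Watson mixture with
hot-set tail constant `c₀ = 2/5` (the skeleton composition applied to the now-proved Hartman–Watson theorem).
[cite: HartmanWatson1974, Theorem] -/
theorem hartmanWatsonMixture_proof :
    Summit.QuantumFields.YangMills.Theses.WilsonVillainDualStiffness.HartmanWatsonMixture :=
  hartmanWatsonMixture_of_law HartmanWatsonLaw_holds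

/-- The same statement as the decl of the second route wanting the shared item,
`WilsonVillainPerimeterTransfer.HartmanWatsonMixture`. [cite: HartmanWatson1974, Theorem] -/
theorem hartmanWatsonMixture_proof' :
    Summit.QuantumFields.YangMills.Theses.WilsonVillainPerimeterTransfer.HartmanWatsonMixture :=
  hartmanWatsonMixture_of_law' HartmanWatsonLaw_holds

end Summit.QuantumFields.YangMills.Theorems
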